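import Summits.MatrixMultiplication.OmegaCensus.BoxUsefulClasses
import Summits.MatrixMultiplication.OmegaCensus.BoxUsefulIndexSix
import Summits.MatrixMultiplication.OmegaCensus.CentreIndexFourLower
import Summits.MatrixMultiplication.OmegaCensus.CentreIndexSixLower

/-!
# ω-census, family (b3): conjecture C9 (c) — the box ratios of the classes `[G:Z] = 4` and `[G:Z] = 6` are EXACTLY `3/2` and `5/3`

HONEST FRAMING (pub-omega census; verbatim): lottery ticket; floor = certified bounds/negative ranges.
Census BOOKKEEPING (conjecture C9 (c) of the cell — 'the box ratio `r(G) = α(G;|G|,3,3)/|G|` takes the value `1, 3/2, 5/3,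
16/9` on the four useful classes'; pub-omega stpp-1 gen 18): the two centre-index classes PACKAGED as single two-sided theorems
about every member, in the shape of `DihC3Sq.Coord2.boxRatio_sixteen_ninths_of_ne` (`DihC3SqMembers`, class `𝒞₂`):
* `three_mul_card_indep_le_of_index_center_six` — the general-box form of NR154's law: `[G:Z(G)] = 6` ⇒ every independent
  cell set `I` of every box `G × Y × W` with `#Y, #W ≤ 3` has `3|I| ≤ 5|G|` (the basic-box law
  `CentreIndexSix.Coord.three_mul_card_indep_le_basic` of `BoxUsefulIndexSix` moved to an arbitrary box by the right
  translation `cellWord_translate`, as inside `BoxUseful.of_index_center_six`, here as a statement of its own);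
* `boxRatio_three_halves_of_index_center_four` — `[G:Z(G)] = 4` ⇒ (`2|I| ≤ 3|G|` for every independent `I` in every
  `3 × 3` box) ∧ (some `3 × 3` box carries an independent `J` with `2|J| = 3|G|`): R311's law in box form
  (`CentreIndexFour.SmallComm.two_mul_card_indep_le`) + the transversal witness `exists_indep_three_halves_of_index_center_four`;
* `boxRatio_five_thirds_of_index_center_six` — `[G:Z(G)] = 6` ⇒ (`3|I| ≤ 5|G|`) ∧ (some box attains `3|J| = 5|G|`): the law
  above + the lifted `S₃` witness `exists_indep_five_thirds_of_index_center_six`;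
* `exists_indep_card` — every finite group with at least three elements has a `3 × 3` box with `|G|` independent cells
  (`r ≥ 1`; the abelian class attains exactly this, `BoxUseful.of_index_center_one`).
So C9 (c) reads, in the kernel and for EVERY member of each class: `r = 3/2` (`[G:Z] = 4`), `r = 5/3` (`[G:Z] = 6`),
`r = 16/9` (non-abelian `𝒞₂`, `DihC3SqMembers`) — three distinct values below the usefulness threshold `9/5`.
Nothing here is progress on `ω`.
-/

namespace Summit.MatrixMultiplication.OmegaCensus

open Finset ProductBoxBound

variable {G : Type*} [Group G] [Fintype G] [DecidableEq G]

omit [Group G] [DecidableEq G] in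
/-- An independent cell set of a box with an empty side is empty. [folklore] -/
theorem card_eq_zero_of_subset_box_empty {Y W : Finset G} (hYW : Y = ∅ ∨ W = ∅) {I : Finset (G × G × G)}
    (hI : I ⊆ univ ×ˢ (Y ×ˢ W)) : #I = 0 := by
  rw [Finset.card_eq_zero, Finset.eq_empty_iff_forall_notMem]
  intro P hP
  have h := hI hP
  simp only [mem_product, mem_univ, true_and] at h
  rcases hYW with e | e
  · rw [e] at h; exact Finset.notMem_empty _ h.1
  · rw [e] at h; exact Finset.notMem_empty _ h.2

/-- **General-box law of the class `[G:Z(G)] = 6`** (NR154 in box form, arbitrary box): every independent cell set `I` of a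
box `G × Y × W` with `#Y ≤ 3`, `#W ≤ 3` has `3|I| ≤ 5|G|`. [folklore] -/
theorem three_mul_card_indep_le_of_index_center_six (h6 : (Subgroup.center G).index = 6) {Y W : Finset G}
    (hY : #Y ≤ 3) (hW : #W ≤ 3) {I : Finset (G × G × G)} (hI : I ⊆ univ ×ˢ (Y ×ˢ W))
    (hind : ∀ P ∈ I, ∀ P' ∈ I, P ≠ P' → cellWord P P' ≠ 1) : 3 * #I ≤ 5 * Fintype.card G := by
  classical
  obtain ⟨c, κ, ε, hc⟩ := CentreIndexSix.exists_coord h6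
  rcases Y.eq_empty_or_nonempty with hYe | ⟨y₀, hy₀⟩
  · rw [card_eq_zero_of_subset_box_empty (Or.inl hYe) hI]; exact Nat.zero_le _
  rcases W.eq_empty_or_nonempty with hWe | ⟨w₀, hw₀⟩
  · rw [card_eq_zero_of_subset_box_empty (Or.inr hWe) hI]; exact Nat.zero_le _
  let τ : G × G × G → G × G × G := fun P => (P.1, (P.2.1 * y₀⁻¹, P.2.2 * w₀⁻¹))
  have τinj : Function.Injective τ := by
    rintro ⟨x, y, w⟩ ⟨x', y', w'⟩ e
    simp only [τ, Prod.mk.injEq] at e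
    obtain ⟨ex, ey, ew⟩ := e
    rw [ex, mul_right_cancel ey, mul_right_cancel ew]
  set V : Finset (G × G × G) := I.image τ with hVdef
  have hVb : V ⊆ univ ×ˢ (Y.image (· * y₀⁻¹) ×ˢ W.image (· * w₀⁻¹)) := by
    intro Q hQ
    obtain ⟨P, hP, rfl⟩ := Finset.mem_image.1 hQ
    have hPb := hI hP
    simp only [Finset.mem_product, Finset.mem_univ, true_and] at hPb
    simp only [τ, Finset.mem_product, Finset.mem_univ, true_and, Finset.mem_image]
    exact ⟨⟨P.2.1, hPb.1, rfl⟩, ⟨P.2.2, hPb.2, rfl⟩⟩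
  have hindV : ∀ Q ∈ V, ∀ Q' ∈ V, Q ≠ Q' → CentreIndexSix.E Q Q' ≠ 1 := by
    intro Q hQ Q' hQ' hne
    obtain ⟨P, hP, rfl⟩ := Finset.mem_image.1 hQ
    obtain ⟨P', hP', rfl⟩ := Finset.mem_image.1 hQ'
    have hPP : P ≠ P' := fun e => hne (by rw [e])
    have : cellWord (τ P) (τ P') = cellWord P P' := cellWord_translate y₀ w₀ P P'
    intro hE
    apply hind P hP P' hP' hPP
    rw [← this]; exact hE
  have h1Y : (1 : G) ∈ Y.image (· * y₀⁻¹) := Finset.mem_image.2 ⟨y₀, hy₀, mul_inv_cancel y₀⟩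
  have h1W : (1 : G) ∈ W.image (· * w₀⁻¹) := Finset.mem_image.2 ⟨w₀, hw₀, mul_inv_cancel w₀⟩
  have h3 := hc.three_mul_card_indep_le_basic (Finset.card_image_le.trans hY) (Finset.card_image_le.trans hW) h1Y h1W
    hVb hindV
  rwa [hVdef, Finset.card_image_of_injective I τinj] at h3

/-- **C9 (c), class `[G:Z(G)] = 4`: box ratio EXACTLY `3/2` for every member (kernel, both sides).** `2|I| ≤ 3|G|` for every
independent cell set of every `3 × 3` box (R311 in box form), and some `3 × 3` box attains `2|J| = 3|G|`. [folklore] -/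
theorem boxRatio_three_halves_of_index_center_four (h4 : (Subgroup.center G).index = 4) :
    (∀ (Y W : Finset G), #Y ≤ 3 → #W ≤ 3 → ∀ I : Finset (G × G × G), I ⊆ univ ×ˢ (Y ×ˢ W) →
        (∀ P ∈ I, ∀ P' ∈ I, P ≠ P' → cellWord P P' ≠ 1) → 2 * #I ≤ 3 * Fintype.card G) ∧
      ∃ (Y W : Finset G) (J : Finset (G × G × G)), #Y = 3 ∧ #W = 3 ∧ J ⊆ univ ×ˢ (Y ×ˢ W) ∧
        (∀ P ∈ J, ∀ P' ∈ J, P ≠ P' → cellWord P P' ≠ 1) ∧ 2 * #J = 3 * Fintype.card G := by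
  obtain ⟨z, hz⟩ := CentreIndexFour.exists_smallComm h4
  exact ⟨fun Y W hY hW I hI hind => hz.two_mul_card_indep_le hY hW hI hind,
    CentreIndexFour.exists_indep_three_halves_of_index_center_four h4⟩

/-- **C9 (c), class `[G:Z(G)] = 6`: box ratio EXACTLY `5/3` for every member (kernel, both sides).** `3|I| ≤ 5|G|` for every
independent cell set of every `3 × 3` box (NR154 in box form), and some `3 × 3` box attains `3|J| = 5|G|`. [folklore] -/
theorem boxRatio_five_thirds_of_index_center_six (h6 : (Subgroup.center G).index = 6) :
    (∀ (Y W : Finset G), #Y ≤ 3 → #W ≤ 3 → ∀ I : Finset (G × G × G), I ⊆ univ ×ˢ (Y ×ˢ W) →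
        (∀ P ∈ I, ∀ P' ∈ I, P ≠ P' → cellWord P P' ≠ 1) → 3 * #I ≤ 5 * Fintype.card G) ∧
      ∃ (Y W : Finset G) (J : Finset (G × G × G)), #Y = 3 ∧ #W = 3 ∧ J ⊆ univ ×ˢ (Y ×ˢ W) ∧
        (∀ P ∈ J, ∀ P' ∈ J, P ≠ P' → cellWord P P' ≠ 1) ∧ 3 * #J = 5 * Fintype.card G :=
  ⟨fun _ _ hY hW _ hI hind => three_mul_card_indep_le_of_index_center_six h6 hY hW hI hind,
    CentreIndexSix.exists_indep_five_thirds_of_index_center_six h6⟩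

omit [DecidableEq G] in
/-- **Every finite group with at least three elements has box ratio `≥ 1`:** the cells `(g, y₀, w₀)`, `g ∈ G`, of any
`3 × 3` box are independent (`|G|` cells; the abelian class attains exactly this). [folklore] -/
theorem exists_indep_card [DecidableEq G] (h3 : 3 ≤ Fintype.card G) :
    ∃ (Y W : Finset G) (J : Finset (G × G × G)), #Y = 3 ∧ #W = 3 ∧ J ⊆ univ ×ˢ (Y ×ˢ W) ∧
      (∀ P ∈ J, ∀ P' ∈ J, P ≠ P' → cellWord P P' ≠ 1) ∧ #J = Fintype.card G := by
  classical
  obtain ⟨Y, hYu, hY⟩ := Finset.exists_subset_card_eq (s := (univ : Finset G)) (n := 3) (by rwa [card_univ])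
  obtain ⟨y₀, hy₀⟩ : Y.Nonempty := by rw [← Finset.card_pos, hY]; norm_num
  let emb : G ↪ G × G × G := ⟨fun g => (g, y₀, y₀), fun a b e => by simpa using congrArg Prod.fst e⟩
  refine ⟨Y, Y, (univ : Finset G).map emb, hY, hY, ?_, ?_, by rw [card_map, card_univ]⟩
  · intro P hP
    obtain ⟨g, -, rfl⟩ := Finset.mem_map.1 hP
    simp only [emb, Function.Embedding.coeFn_mk, mem_product, mem_univ, true_and]
    exact ⟨hy₀, hy₀⟩
  · intro P hP P' hP' hne h1
    obtain ⟨g, -, rfl⟩ := Finset.mem_map.1 hP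
    obtain ⟨g', -, rfl⟩ := Finset.mem_map.1 hP'
    apply hne
    have : g * g'⁻¹ = 1 := by simpa [cellWord, emb] using h1
    rw [mul_inv_eq_one.1 this]

end Summit.MatrixMultiplication.OmegaCensus
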